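import Summits.BirchSwinnertonDyer.BirchSwinnertonDyer.Theorems.ByReductionTypeAtTwoFineSelmerConjAAtTwoAdditivePotGoodMinkowskiDoor
import HarnessLib

/-!
# Route `ByReductionTypeAtTwo` (rung K4), crux C1″ `FineSelmerConjAAtTwoAdditivePotGood` (item stmt-BirchSwinnertonDyer-22615):
# EXPLICIT MINKOWSKI TOOLKIT — the four kernel lemmas that turn a finite «norm-`ℓ` generator» certificate into `h_K = 1` for a
# cubic field beyond the vacuous range `|d_K| ≤ 108` of `…MinkowskiDoor`
# (a `--supports 22615` file; seat `bsd-2adic-k4-w1` GEN 4; consumed by the per-field files `…ClassNumberOne780` etc.)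

HONEST FRAMING (cell `bsd-2adic`, D-0036/D-0054): UNCONDITIONAL kernel lemmas; closes nothing; nothing booked; BSD is not proved by any
of this. Purpose: for the DOOR rows of the census whose cubic field has `|d| > 108` (so `M_K ≥ 3`), `h = 1` is proved by checking that
every prime ideal of norm `≤ M_K` is principal (Mathlib `RingOfIntegers.isPrincipalIdealRing_of_isPrincipal_of_norm_le_of_isPrime`),
with the following tools:

* `minkowskiBound_lt_of_sqrt_le` — `M_K < B` from `|d_K| ≤ D`, `√D ≤ s` and `(4/3.14)(6/27)s < B` (cubic fields, `π > 3.14`).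
* `exists_sub_natCast_mem_of_absNorm_eq_prime` — if `N(P) = ℓ` is prime then `𝓞/P = 𝔽_ℓ`, so EVERY `θ ∈ 𝓞 K` is `≡ a (mod P)` for
  some `a < ℓ` (counting: `ZMod ℓ → 𝓞/P` is injective by `CharP`, hence bijective).
* `natCast_dvd_of_sub_mem` — if moreover `θ` is a root of `X³ + pX² + qX + r` and `θ ≡ a (mod P)` then `ℓ ∣ a³ + pa² + qa + r`
  (`g(a) = g(a) − g(θ) ∈ P ∩ ℤ`, and `N(P) = ℓ ∣ N(g(a)) = g(a)³`).
* `absNorm_dvd_pow_three_of_natCast_mem` — `ℓ ∈ I ⟹ N(I) ∣ ℓ³`.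
* `eq_span_singleton_of_mem_of_absNorm_eq` — a non-zero ideal `I ∋ α` with `N(I) = |N(α)|` IS `(α)`.
* `norm_coords_eq_det` — `N(x + yθ + zθ²) = det(x + yC + zC²)` for the companion matrix `C` of the cubic (so each certificate
  generator's norm is ONE `norm_num` determinant).

References: [Marcus1977] Ch. 5, Thm. 35–37 and the worked examples after Cor. 2; [Cohen1993] §4.9, §6.3 (class group computation);
[Neukirch1999] I.§6.
-/

set_option autoImplicit false
-- sibling precedent (`…MinkowskiDoor.lean`): the directory name repeats the summit name
set_option linter.dupNamespace false

noncomputable section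

open scoped Classical IntermediateField NumberField Real nonZeroDivisors

namespace Summit.BirchSwinnertonDyer.BirchSwinnertonDyer.Theorems.AddKatoTwo

open Polynomial IsDedekindDomain NumberField Matrix

variable (K : Type) [Field K] [NumberField K]

/-! ## §1 The bound -/

/-- **`M_K < B`** for a cubic number field from `|d_K| ≤ D`, a rational upper bound `s ≥ √D` and `(4/3.14)·(6/27)·s < B`.
[cite: Marcus1977, Ch. 5 Cor. 2 of Thm. 37 (Minkowski bound)] -/
theorem minkowskiBound_lt_of_sqrt_le (h3 : Module.finrank ℚ K = 3) {D : ℕ} (hd : |NumberField.discr K| ≤ D)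
    {s B : ℝ} (hs : √(D : ℝ) ≤ s) (hB : 4 / 3.14 * (6 / 27 * s) < B) :
    (4 / π) ^ NumberField.InfinitePlace.nrComplexPlaces K *
      ((Module.finrank ℚ K).factorial / (Module.finrank ℚ K : ℝ) ^ Module.finrank ℚ K *
        √|(NumberField.discr K : ℝ)|) < B := by
  rw [h3]
  have hc : NumberField.InfinitePlace.nrComplexPlaces K ≤ 1 := by
    have := NumberField.InfinitePlace.card_add_two_mul_card_eq_rank K
    rw [h3] at this
    omega
  have hπ := Real.pi_gt_d2
  have hπpos : 0 < π := Real.pi_pos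
  have h4π : (4 / π) ^ NumberField.InfinitePlace.nrComplexPlaces K ≤ 4 / π := by
    interval_cases NumberField.InfinitePlace.nrComplexPlaces K
    · rw [pow_zero]; rw [le_div_iff₀ hπpos]; linarith [Real.pi_lt_four]
    · rw [pow_one]
  have hd' : |(NumberField.discr K : ℝ)| ≤ D := by
    rw [← Int.cast_abs]; exact_mod_cast hd
  have hsqrt : √|(NumberField.discr K : ℝ)| ≤ s := (Real.sqrt_le_sqrt hd').trans hs
  have hs0 : 0 ≤ s := (Real.sqrt_nonneg _).trans hs
  have hfac : ((3 : ℕ).factorial : ℝ) / (3 : ℝ) ^ 3 = 6 / 27 := by norm_num [Nat.factorial]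
  push_cast
  rw [hfac]
  calc (4 / π) ^ NumberField.InfinitePlace.nrComplexPlaces K * (6 / 27 * √|(NumberField.discr K : ℝ)|)
      ≤ (4 / π) * (6 / 27 * s) := by gcongr
    _ ≤ (4 / 3.14) * (6 / 27 * s) := by gcongr
    _ < B := hB

/-! ## §2 Residues of `θ` modulo a prime of prime norm -/

/-- **If `N(P) = ℓ` is prime, every `θ ∈ 𝓞 K` is congruent mod `P` to a natural number `a < ℓ`** (`𝓞/P` has `ℓ` elements and
characteristic `ℓ`, so `ZMod ℓ → 𝓞/P` is a bijection). [folklore] -/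
theorem exists_sub_natCast_mem_of_absNorm_eq_prime {P : Ideal (𝓞 K)} {ℓ : ℕ} (hℓ : ℓ.Prime)
    (hP : Ideal.absNorm P = ℓ) (θ : 𝓞 K) : ∃ a : ℕ, a < ℓ ∧ θ - (a : 𝓞 K) ∈ P := by
  haveI : Fact ℓ.Prime := ⟨hℓ⟩
  have hP0 : P ≠ ⊥ := by
    intro h; rw [h, Ideal.absNorm_bot] at hP; exact hℓ.ne_zero hP.symm
  haveI : Finite (𝓞 K ⧸ P) := Ideal.finiteQuotientOfFreeOfNeBot P hP0
  haveI := Fintype.ofFinite (𝓞 K ⧸ P)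
  have hcard : Fintype.card (𝓞 K ⧸ P) = ℓ := by
    rw [← Nat.card_eq_fintype_card, ← Submodule.cardQuot_apply, ← Ideal.absNorm_apply, hP]
  haveI : Nontrivial (𝓞 K ⧸ P) := Fintype.one_lt_card_iff_nontrivial.mp (by rw [hcard]; exact hℓ.one_lt)
  have hℓ0 : ((ℓ : ℕ) : 𝓞 K ⧸ P) = 0 := by
    have := Ideal.absNorm_mem P
    rw [hP] at this
    have := Ideal.Quotient.eq_zero_iff_mem.mpr this
    simpa using this
  haveI : CharP (𝓞 K ⧸ P) ℓ := (CharP.charP_iff_prime_eq_zero hℓ).mpr hℓ0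
  let f : ZMod ℓ → 𝓞 K ⧸ P := fun c => ((c.val : ℕ) : 𝓞 K ⧸ P)
  have hinj : Function.Injective f := by
    intro c d hcd
    have h := (CharP.natCast_eq_natCast (𝓞 K ⧸ P) ℓ).mp hcd
    have hc := c.val_lt; have hd := d.val_lt
    rw [Nat.ModEq] at h
    rw [Nat.mod_eq_of_lt hc, Nat.mod_eq_of_lt hd] at h
    exact ZMod.val_injective ℓ h
  have hbij : Function.Bijective f := by
    rw [Fintype.bijective_iff_injective_and_card]
    exact ⟨hinj, by rw [ZMod.card, hcard]⟩
  obtain ⟨c, hc⟩ := hbij.2 (Ideal.Quotient.mk P θ)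
  refine ⟨c.val, c.val_lt, ?_⟩
  rw [← Ideal.Quotient.eq, ← hc]
  exact (map_natCast (Ideal.Quotient.mk P) c.val).symm

/-- **`θ ≡ a (mod P)`, `N(P) = ℓ` and `g(θ) = 0` ⟹ `ℓ ∣ g(a)`** for an integer cubic `g` in a cubic field. [folklore] -/
theorem natCast_dvd_of_sub_mem {P : Ideal (𝓞 K)} {ℓ : ℕ} (hℓ : ℓ.Prime) (hP : Ideal.absNorm P = ℓ)
    (h3 : Module.finrank ℚ K = 3) {θ : 𝓞 K} {p q r : ℤ} (hθ : θ ^ 3 + p * θ ^ 2 + q * θ + r = 0)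
    {a : ℕ} (ha : θ - (a : 𝓞 K) ∈ P) : (ℓ : ℤ) ∣ (a : ℤ) ^ 3 + p * (a : ℤ) ^ 2 + q * a + r := by
  set m : ℤ := (a : ℤ) ^ 3 + p * (a : ℤ) ^ 2 + q * a + r with hm
  have hmem : (m : 𝓞 K) ∈ P := by
    have : (m : 𝓞 K) = -(θ - a) * ((θ ^ 2 + θ * a + (a : 𝓞 K) ^ 2) + p * (θ + a) + q) := by
      rw [hm]; push_cast; linear_combination hθ
    rw [this]
    exact P.mul_mem_right _ (P.neg_mem_iff.mpr ha)
  have hdvd := Ideal.absNorm_dvd_absNorm_of_le ((Ideal.span_singleton_le_iff_mem _).mpr hmem)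
  rw [hP, Ideal.absNorm_span_singleton] at hdvd
  have hnorm : Algebra.norm ℤ (m : 𝓞 K) = m ^ 3 := by
    have : (m : 𝓞 K) = algebraMap ℤ (𝓞 K) m := by simp
    rw [this, Algebra.norm_algebraMap, NumberField.RingOfIntegers.rank, h3]
  rw [hnorm, Int.natAbs_pow] at hdvd
  exact Int.ofNat_dvd_left.mpr (Nat.Prime.dvd_of_dvd_pow hℓ hdvd)

/-- **`ℓ ∈ I ⟹ N(I) ∣ ℓ³`** in a cubic field. [folklore] -/
theorem absNorm_dvd_pow_three_of_natCast_mem (h3 : Module.finrank ℚ K = 3) {I : Ideal (𝓞 K)} {ℓ : ℕ}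
    (hmem : ((ℓ : ℕ) : 𝓞 K) ∈ I) : Ideal.absNorm I ∣ ℓ ^ 3 := by
  have hdvd := Ideal.absNorm_dvd_absNorm_of_le ((Ideal.span_singleton_le_iff_mem _).mpr hmem)
  rw [Ideal.absNorm_span_singleton] at hdvd
  have hnorm : Algebra.norm ℤ ((ℓ : ℕ) : 𝓞 K) = (ℓ : ℤ) ^ 3 := by
    have : ((ℓ : ℕ) : 𝓞 K) = algebraMap ℤ (𝓞 K) ℓ := by simp
    rw [this, Algebra.norm_algebraMap, NumberField.RingOfIntegers.rank, h3]
  rw [hnorm, Int.natAbs_pow] at hdvd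
  simpa using hdvd

/-! ## §3 Principal by one generator -/

/-- **An ideal containing `α` with `N(I) = |N(α)| ≠ 0` is `(α)`.** [folklore] -/
theorem eq_span_singleton_of_mem_of_absNorm_eq {I : Ideal (𝓞 K)} {n : ℕ} (hn : n ≠ 0) (hI : Ideal.absNorm I = n)
    {α : 𝓞 K} (hα : α ∈ I) (hN : (Algebra.norm ℤ α).natAbs = n) : I = Ideal.span {α} := by
  have hle : Ideal.span {α} ≤ I := (Ideal.span_singleton_le_iff_mem _).mpr hα
  obtain ⟨J, hJ⟩ := Ideal.dvd_iff_le.mpr hle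
  have h1 : Ideal.absNorm J = 1 := by
    have := congrArg Ideal.absNorm hJ
    rw [map_mul, Ideal.absNorm_span_singleton, hN, hI] at this
    nth_rewrite 1 [← mul_one n] at this
    exact (Nat.eq_of_mul_eq_mul_left (Nat.pos_of_ne_zero hn) this).symm
  rw [Ideal.absNorm_eq_one_iff] at h1
  rw [hJ, h1, Ideal.mul_top]

/-! ## §4 Norms of `ℤ[θ]`-elements as `3 × 3` determinants -/

/-- **`N(x + yθ + zθ²) = det(x·1 + y·C + z·C²)`**, `C` the companion matrix of the irreducible cubic `X³ + pX² + qX + r` of which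
`θ ∈ 𝓞 K` is a root (`K` cubic); as rationals. Each certificate generator's norm is then a numeric determinant. [folklore] -/
theorem norm_coords_eq_det (h3 : Module.finrank ℚ K = 3) (b : 𝓞 K) {p q r : ℤ}
    (hirr : Irreducible (Cubic.toPoly ⟨1, (p : ℚ), q, r⟩)) (hb : b ^ 3 + p * b ^ 2 + q * b + r = 0) (x y z : ℤ) :
    ((Algebra.norm ℤ (x + y * b + z * b ^ 2) : ℤ) : ℚ) =
      ((x : ℚ) • (1 : Matrix (Fin 3) (Fin 3) ℚ) + (y : ℚ) • !![(0 : ℚ), 0, -r; 1, 0, -q; 0, 1, -p] +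
        (z : ℚ) • !![(0 : ℚ), 0, -r; 1, 0, -q; 0, 1, -p] ^ 2).det := by
  set θ : K := (b : K) with hθdef
  have hfm : (Cubic.toPoly ⟨1, (p : ℚ), q, r⟩).Monic := Cubic.monic_of_a_eq_one'
  have hθK : θ ^ 3 + (p : K) * θ ^ 2 + (q : K) * θ + (r : K) = 0 := by
    have := congrArg (algebraMap (𝓞 K) K) hb
    simpa [hθdef] using this
  have hθQ : θ ^ 3 + ((p : ℚ) : K) * θ ^ 2 + ((q : ℚ) : K) * θ + ((r : ℚ) : K) = 0 := by
    push_cast; exact hθK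
  have hxroot : aeval θ (Cubic.toPoly ⟨1, (p : ℚ), q, r⟩) = 0 := by
    simp only [Cubic.toPoly, map_one, one_mul, aeval_add, aeval_mul, aeval_C, aeval_X_pow, aeval_X,
      eq_ratCast, Rat.cast_intCast]
    exact hθK
  have hint : IsIntegral ℚ θ := ⟨_, hfm, by rwa [← aeval_def]⟩
  have hmin : minpoly ℚ θ = Cubic.toPoly ⟨1, (p : ℚ), q, r⟩ := (minpoly.eq_of_irreducible_of_monic hirr hxroot hfm).symm
  have hnd : (minpoly ℚ θ).natDegree = 3 := by rw [hmin]; exact Cubic.natDegree_of_a_ne_zero' one_ne_zero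
  have hli : LinearIndependent ℚ fun i : Fin 3 => θ ^ (i : ℕ) := by
    have hcomp : (fun i : Fin 3 => θ ^ (i : ℕ)) ∘ (finCongr hnd) =
        fun i : Fin (minpoly ℚ θ).natDegree => θ ^ (i : ℕ) := by
      funext i; simp
    have h0 : LinearIndependent ℚ fun i : Fin (minpoly ℚ θ).natDegree => θ ^ (i : ℕ) := linearIndependent_pow θ
    rw [← hcomp] at h0
    exact (linearIndependent_equiv (finCongr hnd)).mp h0
  let b3 : Module.Basis (Fin 3) ℚ K := basisOfLinearIndependentOfCardEqFinrank hli (by simp [h3])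
  have hb3 : ∀ i, b3 i = θ ^ (i : ℕ) := fun i => by
    simp [b3, coe_basisOfLinearIndependentOfCardEqFinrank]
  have hM := leftMulMatrix_eq_companion θ b3 hb3 hθQ
  rw [Algebra.coe_norm_int, Algebra.norm_eq_matrix_det b3]
  congr 1
  have hx : ((x : 𝓞 K) + y * b + z * b ^ 2 : 𝓞 K) = algebraMap ℚ K x + algebraMap ℚ K y * θ + algebraMap ℚ K z * θ ^ 2 := by
    rw [hθdef]; simp
  rw [hx, map_add, map_add, map_mul, map_mul, map_pow, AlgHom.commutes, AlgHom.commutes, AlgHom.commutes, hM,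
    Algebra.algebraMap_eq_smul_one, Algebra.algebraMap_eq_smul_one, Algebra.algebraMap_eq_smul_one, smul_one_mul,
    smul_one_mul]

/-- Integer form: **`|N(x + yθ + zθ²)| = n`** as soon as the numeric determinant is `± n`. [folklore] -/
theorem natAbs_norm_coords_eq (h3 : Module.finrank ℚ K = 3) (b : 𝓞 K) {p q r : ℤ}
    (hirr : Irreducible (Cubic.toPoly ⟨1, (p : ℚ), q, r⟩)) (hb : b ^ 3 + p * b ^ 2 + q * b + r = 0) (x y z : ℤ) {n : ℕ} {N : ℤ}
    (hdet : ((x : ℚ) • (1 : Matrix (Fin 3) (Fin 3) ℚ) + (y : ℚ) • !![(0 : ℚ), 0, -r; 1, 0, -q; 0, 1, -p] +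
        (z : ℚ) • !![(0 : ℚ), 0, -r; 1, 0, -q; 0, 1, -p] ^ 2).det = N) (hN : N.natAbs = n) :
    (Algebra.norm ℤ ((x : 𝓞 K) + y * b + z * b ^ 2)).natAbs = n := by
  have h := norm_coords_eq_det K h3 b hirr hb x y z
  rw [hdet] at h
  have : Algebra.norm ℤ ((x : 𝓞 K) + y * b + z * b ^ 2) = N := by exact_mod_cast h
  rw [this, hN]

end Summit.BirchSwinnertonDyer.BirchSwinnertonDyer.Theorems.AddKatoTwo

end
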